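import Mathlib.LinearAlgebra.Matrix.SpecialLinearGroup
import Mathlib.LinearAlgebra.Matrix.GeneralLinearGroup.Defs
import Mathlib.Data.Nat.Choose.Sum
import Mathlib.RingTheory.MvPolynomial.Basic
import Mathlib.Algebra.MvPolynomial.CommRing
import Mathlib.RingTheory.MvPolynomial.Homogeneous
import Mathlib.Algebra.MvPolynomial.Monad
import Mathlib.LinearAlgebra.Matrix.MvPolynomial
import HarnessLib

/-!
# The symmetric power representations `Sym^m : SL₂ → GL_{m+1}` (binary forms)

Elementary representation theory of `SL₂` (namespace `Literature.SL2Sym`), needed for the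
homomorphisms `SL₂ → G` realising the roots of a reductive group constructed from a Lie algebra
(Springer, *Linear Algebraic Groups*, 2nd ed., 7.3, 8.1.1 (i), 10.1–10.2; the existence
`theorem` of Chevalley, `Literature.NumberTheory.Automorphic.chevalley_existence`): an integrable `sl₂`-triple acts on each
string
`w, F w, …, F^m w` (`Literature/Algebra/Lie/Sl2Strings.lean`) through the classical action of
`SL₂` on binary forms of degree `m`. Over any commutative ring `k`:

* `symAct g : k[X₀, X₁] →ₐ k[X₀, X₁]`, the substitution `(g · p)(X) = p (X g)`
  (`X_i ↦ ∑_j g_{ji} X_j`); `symAct_one`, **`symAct_mul : symAct (g h) = symAct g ∘ symAct h`**;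
* the degree-`m` monomials `mono m i = X₀^{m-i} X₁^i` (`expo`, `mono_eq`), homogeneity of the
  action (`isHomogeneous_symAct`, Mathlib `IsHomogeneous.aeval`) and the expansion of a binary
  form of degree `m` in the monomials (`eq_sum_coeff_smul_mono`);
* the matrices **`symPowerMat m g`** of the action on degree-`m` forms
  (`symAct_mono : g · X₀^{m-j} X₁^j = ∑_i Sym^m(g)_{ij} X₀^{m-i} X₁^i`), with `symPowerMat_one`,
  **`symPowerMat_mul`** (so `symPowerMonoidHom m : Mat₂ →* Mat_{m+1}`) and the group homomorphism
  **`symPowerGL m : SL₂(k) →* GL_{m+1}(k)`** (`coe_symPowerGL`);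
* explicit formulas: `symPowerMat_diagonal` (`diag(a, d) ↦ diag (a^{m-j} d^j)`, so the torus
  `diag(t, t⁻¹)` acts with weights `m - 2j`), `symPowerMat_upper`
  (`[[1, x], [0, 1]] ↦ (C(j, i) x^{j-i})_{i ≤ j}`) and `symPowerMat_lower`
  (`[[1, 0], [x, 1]] ↦ (C(m-j, i-j) x^{i-j})_{j ≤ i}`), from the binomial theorem
  (`symAct_upper_mono`, `symAct_lower_mono`).

* naturality in the coefficient ring (`map_symAct`, `symPowerMat_map`) and the **polynomiality of
  the entries** of `Sym^m (g)` in the entries of `g` (`eval_symPowerMat_mvPolynomialX`,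
  `aeval_symPowerMat_mvPolynomialX`, via Mathlib's generic matrix `Matrix.mvPolynomialX`), i.e.
  the algebraicity of `Sym^m`.

These are the matrices of `exp (x E)`, `exp (x F)` and `t^H` on a string of an `sl₂`-module in the
basis `F^j w / (m - j)!`-renormalised monomials; the identification is made in the sequel.

## Mathlib

`MvPolynomial.aeval`, `MvPolynomial.algHom_ext`, `MvPolynomial.IsHomogeneous` (`.aeval`,
`.coeff_eq_zero`, `isHomogeneous_monomial`), `Finsupp.degree`, `add_pow`,
`Matrix.SpecialLinearGroup.toGL`, `MonoidHom.toHomUnits`, and the generic matrix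
`Matrix.mvPolynomialX` with `Matrix.mvPolynomialX_map_eval₂` (polynomiality of the entries).
Mathlib has no symmetric power representation of `SL₂` or `GL₂` on binary forms (`lean search`
for `SpecialLinearGroup` with `MvPolynomial`/`aeval`, `symPow`, `binary form`: no hits); nothing
here duplicates a Mathlib declaration.

## References

* T. A. Springer, *Linear Algebraic Groups*, 2nd ed. (1998), 7.3, 8.1.1, 10.1.1 [SpringerLAG1998].
* J. E. Humphreys, *Introduction to Lie Algebras and Representation Theory*, GTM 9 (1972), §7.2.
-/

noncomputable section

open MvPolynomial

namespace Literature.RepresentationTheory.AlgebraicGroups.SL2Sym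

variable {k : Type*} [CommRing k]

/-- The substitution action of a `2 × 2` matrix `g` on `k[X₀, X₁]`:
`(g · p)(X) = p (X g)`, i.e. `X_i ↦ ∑_j g j i • X_j`. [folklore] -/
def symAct (g : Matrix (Fin 2) (Fin 2) k) : MvPolynomial (Fin 2) k →ₐ[k] MvPolynomial (Fin 2) k :=
  MvPolynomial.aeval fun i => ∑ j : Fin 2, MvPolynomial.C (g j i) * MvPolynomial.X j

/-- `symAct g` on a variable. [folklore] -/
@[simp] lemma symAct_X (g : Matrix (Fin 2) (Fin 2) k) (i : Fin 2) :
    symAct g (X i) = ∑ j : Fin 2, C (g j i) * X j := by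
  simp [symAct]

/-- The identity matrix acts trivially. [folklore] -/
lemma symAct_one : symAct (1 : Matrix (Fin 2) (Fin 2) k) = AlgHom.id k _ := by
  refine MvPolynomial.algHom_ext fun i => ?_
  rw [symAct_X, AlgHom.id_apply, Fin.sum_univ_two]
  fin_cases i <;> simp [Matrix.one_apply]

/-- **The substitution action is multiplicative**: `(g h) · p = g · (h · p)`. [folklore] -/
lemma symAct_mul (g h : Matrix (Fin 2) (Fin 2) k) :
    symAct (g * h) = (symAct g).comp (symAct h) := by
  refine MvPolynomial.algHom_ext fun i => ?_
  rw [AlgHom.comp_apply, symAct_X, symAct_X, map_sum]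
  simp only [map_mul, MvPolynomial.algHom_C, symAct_X, Matrix.mul_apply, Fin.sum_univ_two,
    map_add, add_mul, mul_add, MvPolynomial.algebraMap_eq]
  ring

/-! ### Degree-`m` monomials and the matrices `Sym^m (g)` -/

/-- The exponent of the monomial `X₀^{m-i} X₁^i`. [folklore] -/
def expo (m i : ℕ) : Fin 2 →₀ ℕ := Finsupp.single 0 (m - i) + Finsupp.single 1 i

/-- The monomial `X₀^{m-i} X₁^i`. [folklore] -/
def mono (m i : ℕ) : MvPolynomial (Fin 2) k := MvPolynomial.monomial (expo m i) 1

omit [CommRing k] in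
/-- `expo m i 0 = m - i`. [folklore] -/
lemma expo_apply_zero (m i : ℕ) : expo m i 0 = m - i := by simp [expo]

omit [CommRing k] in
/-- `expo m i 1 = i`. [folklore] -/
lemma expo_apply_one (m i : ℕ) : expo m i 1 = i := by simp [expo]

omit [CommRing k] in
/-- The degree of `expo m i` is `m` for `i ≤ m`. [folklore] -/
lemma degree_expo {m i : ℕ} (hi : i ≤ m) : (expo m i).degree = m := by
  rw [Finsupp.degree_eq_sum, Fin.sum_univ_two, expo_apply_zero, expo_apply_one]
  omega

omit [CommRing k] in
/-- `expo m` is injective (the second component recovers `i`). [folklore] -/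
lemma expo_injective (m : ℕ) : Function.Injective (expo m) := by
  intro i j h
  have h1 := congrArg (fun d => d 1) h
  simpa [expo_apply_one] using h1

omit [CommRing k] in
/-- A degree-`m` exponent in two variables is an `expo m i`, `i ≤ m`. [folklore] -/
lemma eq_expo_of_degree_eq {m : ℕ} {d : Fin 2 →₀ ℕ} (hd : d.degree = m) :
    d = expo m (d 1) ∧ d 1 ≤ m := by
  rw [Finsupp.degree_eq_sum, Fin.sum_univ_two] at hd
  refine ⟨Finsupp.ext fun i => ?_, by omega⟩
  fin_cases i
  · simp [expo_apply_zero]; omega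
  · simp [expo_apply_one]

/-- `mono m i = X₀^{m-i} X₁^i`. [folklore] -/
lemma mono_eq (m i : ℕ) : (mono m i : MvPolynomial (Fin 2) k) = X 0 ^ (m - i) * X 1 ^ i := by
  rw [mono, expo, MvPolynomial.monomial_single_add, MvPolynomial.X_pow_eq_monomial,
    MvPolynomial.X_pow_eq_monomial, MvPolynomial.monomial_mul, one_mul]

/-- `symAct g` preserves homogeneity and degree (linear substitution). [folklore] -/
lemma isHomogeneous_symAct (g : Matrix (Fin 2) (Fin 2) k) {φ : MvPolynomial (Fin 2) k} {m : ℕ}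
    (hφ : φ.IsHomogeneous m) : (symAct g φ).IsHomogeneous m := by
  have h := hφ.aeval (fun i => ∑ j : Fin 2, C (g j i) * X j)
    (fun i => IsHomogeneous.sum _ _ 1 fun j _ => isHomogeneous_C_mul_X _ _)
  simpa [symAct] using h

/-- A homogeneous polynomial of degree `m` in two variables is the combination of the `mono m i`
with its coefficients. [folklore] -/
lemma eq_sum_coeff_smul_mono {φ : MvPolynomial (Fin 2) k} {m : ℕ} (hφ : φ.IsHomogeneous m) :
    φ = ∑ i : Fin (m + 1), MvPolynomial.coeff (expo m i) φ • mono m i := by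
  refine MvPolynomial.ext _ _ fun d => ?_
  simp only [MvPolynomial.coeff_sum, MvPolynomial.coeff_smul, mono, MvPolynomial.coeff_monomial,
    smul_eq_mul, mul_ite, mul_one, mul_zero]
  by_cases hd : d.degree = m
  · obtain ⟨hde, hle⟩ := eq_expo_of_degree_eq hd
    rw [Finset.sum_eq_single (⟨d 1, Nat.lt_succ_of_le hle⟩ : Fin (m + 1))]
    · simp [← hde]
    · intro i _ hi
      rw [if_neg]
      intro h
      apply hi
      apply Fin.ext
      have h1 := congrArg (fun e => e 1) h
      simp only [expo_apply_one] at h1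
      simpa using h1
    · simp
  · rw [hφ.coeff_eq_zero hd]
    symm
    refine Finset.sum_eq_zero fun i _ => ?_
    rw [if_neg]
    intro h
    apply hd
    rw [← h]
    exact degree_expo (Nat.le_of_lt_succ i.2)

/-- **The matrix `Sym^m (g)`** of the substitution action on degree-`m` forms, in the monomial
basis `X₀^{m-i} X₁^i`: `g · (X₀^{m-j} X₁^j) = ∑_i Sym^m(g)_{ij} X₀^{m-i} X₁^i`. [folklore] -/
def symPowerMat (m : ℕ) (g : Matrix (Fin 2) (Fin 2) k) : Matrix (Fin (m + 1)) (Fin (m + 1)) k :=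
  Matrix.of fun i j => MvPolynomial.coeff (expo m i) (symAct g (mono m j))

/-- The expansion of `g · X₀^{m-j} X₁^j`. [folklore] -/
lemma symAct_mono (m : ℕ) (g : Matrix (Fin 2) (Fin 2) k) (j : Fin (m + 1)) :
    symAct g (mono m j) = ∑ i : Fin (m + 1), symPowerMat m g i j • mono m i := by
  have hh : (mono m j : MvPolynomial (Fin 2) k).IsHomogeneous m :=
    isHomogeneous_monomial _ (degree_expo (Nat.le_of_lt_succ j.2))
  conv_lhs => rw [eq_sum_coeff_smul_mono (isHomogeneous_symAct g hh)]
  rfl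

/-- `Sym^m (1) = 1`. [folklore] -/
lemma symPowerMat_one (m : ℕ) : symPowerMat m (1 : Matrix (Fin 2) (Fin 2) k) = 1 := by
  ext i j
  simp only [symPowerMat, Matrix.of_apply, symAct_one, AlgHom.id_apply, mono,
    MvPolynomial.coeff_monomial, Matrix.one_apply]
  by_cases h : i = j
  · subst h; simp
  · rw [if_neg (fun h' => h (Fin.ext (by
      have h1 := congrArg (fun e => e 1) h'
      simpa [expo_apply_one] using h1.symm))), if_neg h]

/-- **`Sym^m` is multiplicative**: `Sym^m (g h) = Sym^m (g) Sym^m (h)`. [folklore] -/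
lemma symPowerMat_mul (m : ℕ) (g h : Matrix (Fin 2) (Fin 2) k) :
    symPowerMat m (g * h) = symPowerMat m g * symPowerMat m h := by
  ext i j
  have key : symAct (g * h) (mono m j) =
      ∑ i : Fin (m + 1), (∑ l : Fin (m + 1), symPowerMat m g i l * symPowerMat m h l j) •
        mono m i := by
    rw [symAct_mul, AlgHom.comp_apply, symAct_mono m h j, map_sum]
    simp only [map_smul, symAct_mono m g, Finset.smul_sum, smul_smul]
    rw [Finset.sum_comm]
    refine Finset.sum_congr rfl fun i _ => ?_
    rw [← Finset.sum_smul]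
    refine congrArg (· • mono m i) (Finset.sum_congr rfl fun l _ => mul_comm _ _)
  have hc := congrArg (MvPolynomial.coeff (expo m i)) key
  simp only [MvPolynomial.coeff_sum, MvPolynomial.coeff_smul, mono, MvPolynomial.coeff_monomial,
    smul_eq_mul, mul_ite, mul_one, mul_zero] at hc
  rw [Finset.sum_eq_single i, if_pos rfl] at hc
  · rw [Matrix.mul_apply]
    simpa [symPowerMat, mono] using hc
  · intro i' _ hi'
    rw [if_neg]
    intro h'
    exact hi' (Fin.ext (expo_injective m h'))
  · simp

/-! ### `Sym^m` as a homomorphism `SL₂ → GL_{m+1}` -/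

/-- `Sym^m` as a monoid homomorphism on `2 × 2` matrices. [folklore] -/
def symPowerMonoidHom (m : ℕ) :
    Matrix (Fin 2) (Fin 2) k →* Matrix (Fin (m + 1)) (Fin (m + 1)) k where
  toFun := symPowerMat m
  map_one' := symPowerMat_one m
  map_mul' := symPowerMat_mul m

/-- **The symmetric power representation `Sym^m : SL₂(k) → GL_{m+1}(k)`** (substitution action
on binary forms of degree `m`, in the monomial basis `X₀^{m-i} X₁^i`). [folklore] -/
def symPowerGL (m : ℕ) : Matrix.SpecialLinearGroup (Fin 2) k →* GL (Fin (m + 1)) k :=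
  ((symPowerMonoidHom m).comp
    ((Units.coeHom _).comp (Matrix.SpecialLinearGroup.toGL :
      Matrix.SpecialLinearGroup (Fin 2) k →* GL (Fin 2) k))).toHomUnits

/-- The matrix of `symPowerGL m g` is `Sym^m (g)`. [folklore] -/
@[simp] lemma coe_symPowerGL (m : ℕ) (g : Matrix.SpecialLinearGroup (Fin 2) k) :
    ((symPowerGL m g : GL (Fin (m + 1)) k) : Matrix (Fin (m + 1)) (Fin (m + 1)) k) =
      symPowerMat m (g : Matrix (Fin 2) (Fin 2) k) := rfl

/-! ### Explicit formulas: diagonal and unipotent elements -/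

section Formulas

variable (m : ℕ)

/-- The coefficient of `X₀^{m-i} X₁^i` in `c • X₀^{m-j} X₁^j`. [folklore] -/
lemma coeff_expo_smul_mono (c : k) (i j : Fin (m + 1)) :
    MvPolynomial.coeff (expo m i) (c • (mono m j : MvPolynomial (Fin 2) k)) =
      if i = j then c else 0 := by
  rw [MvPolynomial.coeff_smul, mono, MvPolynomial.coeff_monomial, smul_eq_mul, mul_ite, mul_one,
    mul_zero]
  by_cases h : i = j
  · subst h; simp
  · rw [if_neg (fun h' => h (Fin.ext (expo_injective m h')).symm), if_neg h]

/-- `diag(a, d)` substitutes `X₀ ↦ a X₀`. [folklore] -/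
lemma symAct_diagonal_X_zero (a d : k) :
    symAct (Matrix.diagonal ![a, d]) (X 0 : MvPolynomial (Fin 2) k) = C a * X 0 := by
  rw [symAct_X, Fin.sum_univ_two]
  simp

/-- `diag(a, d)` substitutes `X₁ ↦ d X₁`. [folklore] -/
lemma symAct_diagonal_X_one (a d : k) :
    symAct (Matrix.diagonal ![a, d]) (X 1 : MvPolynomial (Fin 2) k) = C d * X 1 := by
  rw [symAct_X, Fin.sum_univ_two]
  simp

/-- `diag(a, d) · X₀^{m-j} X₁^j = a^{m-j} d^j X₀^{m-j} X₁^j`. [folklore] -/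
lemma symAct_diagonal_mono (a d : k) (j : ℕ) :
    symAct (Matrix.diagonal ![a, d]) (mono m j : MvPolynomial (Fin 2) k) =
      (a ^ (m - j) * d ^ j) • mono m j := by
  rw [mono_eq, map_mul, map_pow, map_pow, symAct_diagonal_X_zero, symAct_diagonal_X_one, mul_pow,
    mul_pow, ← C_pow, ← C_pow, smul_eq_C_mul, C_mul]
  ring

/-- **`Sym^m` of a diagonal matrix**: `diag (a^{m-j} d^j)`. [folklore] -/
lemma symPowerMat_diagonal (a d : k) (i j : Fin (m + 1)) :
    symPowerMat m (Matrix.diagonal ![a, d]) i j =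
      if i = j then a ^ (m - (j : ℕ)) * d ^ (j : ℕ) else 0 := by
  rw [symPowerMat, Matrix.of_apply, symAct_diagonal_mono, coeff_expo_smul_mono]

/-- `!![1, x; 0, 1]` substitutes `X₀ ↦ X₀`. [folklore] -/
lemma symAct_upper_X_zero (x : k) :
    symAct !![1, x; 0, 1] (X 0 : MvPolynomial (Fin 2) k) = X 0 := by
  rw [symAct_X, Fin.sum_univ_two]
  simp

/-- `!![1, x; 0, 1]` substitutes `X₁ ↦ x X₀ + X₁`. [folklore] -/
lemma symAct_upper_X_one (x : k) :
    symAct !![1, x; 0, 1] (X 1 : MvPolynomial (Fin 2) k) = C x * X 0 + X 1 := by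
  rw [symAct_X, Fin.sum_univ_two]
  simp

/-- **`!![1, x; 0, 1] · X₀^{m-j} X₁^j = ∑_{q ≤ j} C(j,q) x^{j-q} X₀^{m-q} X₁^q`.** [folklore] -/
lemma symAct_upper_mono (x : k) {j : ℕ} (hj : j ≤ m) :
    symAct !![1, x; 0, 1] (mono m j : MvPolynomial (Fin 2) k) =
      ∑ q ∈ Finset.range (j + 1), ((j.choose q : k) * x ^ (j - q)) • mono m q := by
  rw [mono_eq, map_mul, map_pow, map_pow, symAct_upper_X_zero, symAct_upper_X_one,
    add_pow (C x * X 0) (X 1) j, Finset.mul_sum]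
  -- reindex `q ↦ j - q`... we instead match termwise after reflecting the sum
  rw [← Finset.sum_range_reflect]
  refine Finset.sum_congr rfl fun q hq => ?_
  have hq' : q ≤ j := Nat.le_of_lt_succ (Finset.mem_range.mp hq)
  rw [show j + 1 - 1 - q = j - q from by omega, Nat.sub_sub_self hq', Nat.choose_symm hq', mono_eq,
    mul_pow, ← C_pow, smul_eq_C_mul, C_mul,
    ← map_natCast (C : k →+* MvPolynomial (Fin 2) k) (j.choose q)]
  have e : m - j + (j - q) = m - q := by omega
  rw [← e, pow_add]
  ring

/-- **`Sym^m` of `!![1, x; 0, 1]` is upper triangular with binomial entries**: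
`Sym^m(u(x))_{ij} = C(j, i) x^{j-i}` for `i ≤ j`, else `0`. [folklore] -/
lemma symPowerMat_upper (x : k) (i j : Fin (m + 1)) :
    symPowerMat m !![1, x; 0, 1] i j =
      if (i : ℕ) ≤ j then ((j : ℕ).choose i : k) * x ^ ((j : ℕ) - i) else 0 := by
  rw [symPowerMat, Matrix.of_apply, symAct_upper_mono m x (Nat.le_of_lt_succ j.2),
    MvPolynomial.coeff_sum]
  have hterm : ∀ q ∈ Finset.range ((j : ℕ) + 1),
      MvPolynomial.coeff (expo m i) ((((j : ℕ).choose q : k) * x ^ ((j : ℕ) - q)) •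
        (mono m q : MvPolynomial (Fin 2) k)) =
        if (i : ℕ) = q then ((j : ℕ).choose q : k) * x ^ ((j : ℕ) - q) else 0 := by
    intro q hq
    have hq' : q < m + 1 := lt_of_lt_of_le (Finset.mem_range.mp hq) (Nat.succ_le_succ
      (Nat.le_of_lt_succ j.2))
    have h := coeff_expo_smul_mono m (((j : ℕ).choose q : k) * x ^ ((j : ℕ) - q)) i ⟨q, hq'⟩
    simp only [Fin.ext_iff] at h
    exact h
  rw [Finset.sum_congr rfl hterm, Finset.sum_ite_eq]
  by_cases h : (i : ℕ) ≤ j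
  · rw [if_pos (Finset.mem_range.mpr (Nat.lt_succ_of_le h)), if_pos h]
  · rw [if_neg (fun h' => h (Nat.le_of_lt_succ (Finset.mem_range.mp h'))), if_neg h]

/-- `!![1, 0; x, 1]` substitutes `X₀ ↦ X₀ + x X₁`. [folklore] -/
lemma symAct_lower_X_zero (x : k) :
    symAct !![1, 0; x, 1] (X 0 : MvPolynomial (Fin 2) k) = X 0 + C x * X 1 := by
  rw [symAct_X, Fin.sum_univ_two]
  simp

/-- `!![1, 0; x, 1]` substitutes `X₁ ↦ X₁`. [folklore] -/
lemma symAct_lower_X_one (x : k) :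
    symAct !![1, 0; x, 1] (X 1 : MvPolynomial (Fin 2) k) = X 1 := by
  rw [symAct_X, Fin.sum_univ_two]
  simp

/-- **`!![1, 0; x, 1] · X₀^{m-j} X₁^j = ∑_{p ≤ m-j} C(m-j, p) x^p X₀^{m-j-p} X₁^{j+p}`.**
[folklore] -/
lemma symAct_lower_mono (x : k) (j : ℕ) :
    symAct !![1, 0; x, 1] (mono m j : MvPolynomial (Fin 2) k) =
      ∑ p ∈ Finset.range (m - j + 1), (((m - j).choose p : k) * x ^ p) • mono m (j + p) := by
  rw [mono_eq, map_mul, map_pow, map_pow, symAct_lower_X_zero, symAct_lower_X_one,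
    add_comm (X 0 : MvPolynomial (Fin 2) k), add_pow (C x * X 1) (X 0) (m - j), Finset.sum_mul]
  refine Finset.sum_congr rfl fun p hp => ?_
  have hp' : p ≤ m - j := Nat.le_of_lt_succ (Finset.mem_range.mp hp)
  rw [mono_eq, mul_pow, ← C_pow, smul_eq_C_mul, C_mul,
    ← map_natCast (C : k →+* MvPolynomial (Fin 2) k) ((m - j).choose p),
    show m - (j + p) = m - j - p from by omega, pow_add]
  ring

/-- **`Sym^m` of `!![1, 0; x, 1]` is lower triangular with binomial entries**:
`Sym^m(v(x))_{ij} = C(m - j, i - j) x^{i-j}` for `j ≤ i`, else `0`. [folklore] -/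
lemma symPowerMat_lower (x : k) (i j : Fin (m + 1)) :
    symPowerMat m !![1, 0; x, 1] i j =
      if (j : ℕ) ≤ i then ((m - j : ℕ).choose (i - j) : k) * x ^ ((i : ℕ) - j) else 0 := by
  rw [symPowerMat, Matrix.of_apply, symAct_lower_mono m x j, MvPolynomial.coeff_sum]
  have hterm : ∀ p ∈ Finset.range (m - j + 1),
      MvPolynomial.coeff (expo m i) ((((m - j : ℕ).choose p : k) * x ^ p) •
        (mono m (j + p) : MvPolynomial (Fin 2) k)) =
        if (i : ℕ) = j + p then ((m - j : ℕ).choose p : k) * x ^ p else 0 := by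
    intro p hp
    have hp' : (j : ℕ) + p < m + 1 := by
      have := Finset.mem_range.mp hp
      have := j.2
      omega
    have h := coeff_expo_smul_mono m (((m - j : ℕ).choose p : k) * x ^ p) i ⟨j + p, hp'⟩
    simp only [Fin.ext_iff] at h
    exact h
  rw [Finset.sum_congr rfl hterm]
  by_cases h : (j : ℕ) ≤ i
  · rw [if_pos h, Finset.sum_eq_single ((i : ℕ) - j)]
    · rw [if_pos (by omega)]
    · intro p _ hp
      rw [if_neg]
      omega
    · intro hnot
      exfalso
      apply hnot
      rw [Finset.mem_range]
      have := i.2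
      omega
  · rw [if_neg h]
    refine Finset.sum_eq_zero fun p _ => ?_
    rw [if_neg]
    omega

end Formulas

/-! ### Naturality and polynomiality of the entries of `Sym^m (g)` -/

section Natural

variable {k' : Type*} [CommRing k']

/-- `symAct` is natural in the coefficient ring. [folklore] -/
lemma map_symAct (f : k →+* k') (g : Matrix (Fin 2) (Fin 2) k) (p : MvPolynomial (Fin 2) k) :
    MvPolynomial.map f (symAct g p) = symAct (g.map f) (MvPolynomial.map f p) := by
  rw [symAct, symAct, MvPolynomial.aeval_eq_bind₁, MvPolynomial.aeval_eq_bind₁,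
    MvPolynomial.map_bind₁]
  congr 2
  funext i
  simp [MvPolynomial.map_C, MvPolynomial.map_X, Matrix.map_apply]

/-- **`Sym^m` is natural in the coefficient ring**: `Sym^m (f g) = f (Sym^m g)` entrywise.
[folklore] -/
lemma symPowerMat_map (f : k →+* k') (m : ℕ) (g : Matrix (Fin 2) (Fin 2) k) :
    symPowerMat m (g.map f) = (symPowerMat m g).map f := by
  ext i j
  rw [Matrix.map_apply, symPowerMat, symPowerMat, Matrix.of_apply, Matrix.of_apply,
    ← MvPolynomial.coeff_map, map_symAct]
  congr 2
  rw [mono, mono, MvPolynomial.map_monomial, f.map_one]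

/-- **The entries of `Sym^m (g)` are polynomials in the entries of `g`** (with coefficients in
`k`; indeed integral binomial expressions): `Sym^m(g)_{ij} = P_{ij} (g)` for the universal
polynomials `P_{ij} = Sym^m (X)_{ij}`, `X = Matrix.mvPolynomialX (Fin 2) (Fin 2) k` Mathlib's
generic matrix. This is the algebraicity of the representation `Sym^m : SL₂ → GL_{m+1}`.
[folklore] -/
theorem eval_symPowerMat_mvPolynomialX (m : ℕ) (g : Matrix (Fin 2) (Fin 2) k)
    (i j : Fin (m + 1)) :
    MvPolynomial.eval (fun ab : Fin 2 × Fin 2 => g ab.1 ab.2)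
        (symPowerMat m (Matrix.mvPolynomialX (Fin 2) (Fin 2) k) i j) = symPowerMat m g i j := by
  have h := symPowerMat_map (MvPolynomial.eval fun ab : Fin 2 × Fin 2 => g ab.1 ab.2) m
    (Matrix.mvPolynomialX (Fin 2) (Fin 2) k)
  rw [← RingHom.mapMatrix_apply, Matrix.mvPolynomialX_mapMatrix_eval] at h
  rw [h, Matrix.map_apply]

/-- The same over any commutative `k`-algebra `S`: `Sym^m(g)_{ij} = aeval g (P_{ij})` for
`g ∈ Mat₂(S)` and the universal polynomials `P_{ij} ∈ k[x_{ab}]` above. [folklore] -/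
theorem aeval_symPowerMat_mvPolynomialX {S : Type*} [CommRing S] [Algebra k S] (m : ℕ)
    (g : Matrix (Fin 2) (Fin 2) S) (i j : Fin (m + 1)) :
    MvPolynomial.aeval (fun ab : Fin 2 × Fin 2 => g ab.1 ab.2)
        (symPowerMat m (Matrix.mvPolynomialX (Fin 2) (Fin 2) k) i j) = symPowerMat m g i j := by
  have h := symPowerMat_map
    (MvPolynomial.eval₂Hom (algebraMap k S) fun ab : Fin 2 × Fin 2 => g ab.1 ab.2) m
    (Matrix.mvPolynomialX (Fin 2) (Fin 2) k)
  rw [MvPolynomial.coe_eval₂Hom, Matrix.mvPolynomialX_map_eval₂ (algebraMap k S) g] at h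
  rw [MvPolynomial.aeval_def, ← MvPolynomial.coe_eval₂Hom, h, Matrix.map_apply,
    MvPolynomial.coe_eval₂Hom]

end Natural

end Literature.RepresentationTheory.AlgebraicGroups.SL2Sym
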